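import Literature.Analysis.FluidPDE.PlanarBandedChain
import HarnessLib

/-!
# Moving chains: box plateaus with moving edges, by freezing a banded chain at each time

Topic `Literature/Analysis/FluidPDE`. Continuation of `PlanarBandedChain.lean`. There the box plateau `τ_k` of
an element is STATIC over the time slot, which forces the box to contain the whole sweep of a moving element; for
long slides the sweeps of non-consecutive elements collide. Here the four edges of each box move smoothly in time
(`MovingBox`: `a₀ b₀ a₁ b₁ : ℝ → ℝ`, fixed transition length `ρ`), and everything pointwise-in-time is obtained by
FREEZING: `M.frozen t : ChainData` is the static chain with the boxes at time `t`, the cut-off is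
`M.chi k t z = (M.frozen t).chi k t z`, and the regions are `{p | p ∈ (M.frozen p.1).core k}` etc. The well-formedness
`MovingChain.WFB` asks the banded well-formedness of every frozen chain plus smooth edges. New proofs are only: joint
smoothness of the cut-offs (`WFB.contDiff_uncurry_chi`), openness / closedness of the space-time regions (continuity
of the edges), and the assembly of `IsRegionData` from the frozen identities; the packaging (smoothness,
incompressibility, transport and the bound on a slot, vanishing off the boxes / tubes, identification on cores) is
then verbatim (`WFB.transport_move`, …).

Folklore; no named facts. Infrastructure towards a discharge of `acm_compatible_blocks`
(`QuasiSelfSimilarCompatibleBlocks.lean`).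

## References

* G. Alberti, G. Crippa, A. L. Mazzucato, *Exponential self-similar mixing by incompressible
  flows*, J. Amer. Math. Soc. 32 (2019), 445–490, §§7–8 (arXiv:1605.02090).
-/

noncomputable section

open Function Set Filter
open scoped Topology ContDiff

namespace Literature.Analysis.FluidPDE

namespace PlanarKinematics

open Gluing

/-- The plane `ℝ²` as a Euclidean space. [folklore] -/
local notation "E²" => EuclideanSpace ℝ (Fin 2)

/-! ## Moving boxes and moving chains -/

/-- **Moving box plateau data**: the four edges as functions of time and a fixed transition length. [folklore] -/
structure MovingBox where
  /-- left edge, axis `0` -/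
  a₀ : ℝ → ℝ
  /-- right edge, axis `0` -/
  b₀ : ℝ → ℝ
  /-- lower edge, axis `1` -/
  a₁ : ℝ → ℝ
  /-- upper edge, axis `1` -/
  b₁ : ℝ → ℝ
  /-- transition length -/
  ρ : ℝ

namespace MovingBox

/-- The box plateau frozen at time `t`. [folklore] -/
def frz (B : MovingBox) (t : ℝ) : BoxPlateau := ⟨B.a₀ t, B.b₀ t, B.a₁ t, B.b₁ t, B.ρ⟩

/-- The fields of the frozen box. [folklore] -/
@[simp] theorem frz_a₀ (B : MovingBox) (t : ℝ) : (B.frz t).a₀ = B.a₀ t := rfl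
/-- The fields of the frozen box. [folklore] -/
@[simp] theorem frz_b₀ (B : MovingBox) (t : ℝ) : (B.frz t).b₀ = B.b₀ t := rfl
/-- The fields of the frozen box. [folklore] -/
@[simp] theorem frz_a₁ (B : MovingBox) (t : ℝ) : (B.frz t).a₁ = B.a₁ t := rfl
/-- The fields of the frozen box. [folklore] -/
@[simp] theorem frz_b₁ (B : MovingBox) (t : ℝ) : (B.frz t).b₁ = B.b₁ t := rfl
/-- The fields of the frozen box. [folklore] -/
@[simp] theorem frz_ρ (B : MovingBox) (t : ℝ) : (B.frz t).ρ = B.ρ := rfl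

/-- **Smooth edges.** [folklore] -/
structure Smooth (B : MovingBox) : Prop where
  /-- left edge smooth -/
  a₀ : ContDiff ℝ ∞ B.a₀
  /-- right edge smooth -/
  b₀ : ContDiff ℝ ∞ B.b₀
  /-- lower edge smooth -/
  a₁ : ContDiff ℝ ∞ B.a₁
  /-- upper edge smooth -/
  b₁ : ContDiff ℝ ∞ B.b₁

/-- **The moving box plateau is jointly smooth** in `(t, z)`. [folklore] -/
theorem contDiff_uncurry_val (B : MovingBox) (h : B.Smooth) :
    ContDiff ℝ ∞ fun p : ℝ × E² => (B.frz p.1).val p.2 := by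
  have h0 : ContDiff ℝ ∞ fun p : ℝ × E² => p.2 0 := (contDiff_coord 0).comp contDiff_snd
  have h1 : ContDiff ℝ ∞ fun p : ℝ × E² => p.2 1 := (contDiff_coord 1).comp contDiff_snd
  have e : (fun p : ℝ × E² => (B.frz p.1).val p.2) = fun p : ℝ × E² =>
      (step ((p.2 0 - B.a₀ p.1) / B.ρ) * step ((B.b₀ p.1 - p.2 0) / B.ρ)) *
        (step ((p.2 1 - B.a₁ p.1) / B.ρ) * step ((B.b₁ p.1 - p.2 1) / B.ρ)) := by
    funext p; rfl
  rw [e]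
  exact ((step_contDiff.comp ((h0.sub (h.a₀.comp contDiff_fst)).div_const _)).mul
    (step_contDiff.comp (((h.b₀.comp contDiff_fst).sub h0).div_const _))).mul
    ((step_contDiff.comp ((h1.sub (h.a₁.comp contDiff_fst)).div_const _)).mul
      (step_contDiff.comp (((h.b₁.comp contDiff_fst).sub h1).div_const _)))

/-- The space-time inner region of a moving box is open (continuous edges). [folklore] -/
theorem isOpen_inner (B : MovingBox) (h : B.Smooth) : IsOpen {p : ℝ × E² | p.2 ∈ (B.frz p.1).inner} := by
  have h0 : Continuous fun p : ℝ × E² => p.2 0 := (EuclideanSpace.proj (0 : Fin 2)).continuous.comp continuous_snd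
  have h1 : Continuous fun p : ℝ × E² => p.2 1 := (EuclideanSpace.proj (1 : Fin 2)).continuous.comp continuous_snd
  have ca₀ : Continuous fun p : ℝ × E² => B.a₀ p.1 + 2 * B.ρ / 3 :=
    (h.a₀.continuous.comp continuous_fst).add continuous_const
  have cb₀ : Continuous fun p : ℝ × E² => B.b₀ p.1 - 2 * B.ρ / 3 :=
    (h.b₀.continuous.comp continuous_fst).sub continuous_const
  have ca₁ : Continuous fun p : ℝ × E² => B.a₁ p.1 + 2 * B.ρ / 3 :=
    (h.a₁.continuous.comp continuous_fst).add continuous_const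
  have cb₁ : Continuous fun p : ℝ × E² => B.b₁ p.1 - 2 * B.ρ / 3 :=
    (h.b₁.continuous.comp continuous_fst).sub continuous_const
  have ho := (((isOpen_lt ca₀ h0).inter (isOpen_lt h0 cb₀)).inter (isOpen_lt ca₁ h1)).inter (isOpen_lt h1 cb₁)
  convert ho using 1
  ext p
  simp only [mem_setOf_eq, BoxPlateau.inner, mem_inter_iff]
  tauto

/-- The space-time support region of a moving box is closed (continuous edges). [folklore] -/
theorem isClosed_supp (B : MovingBox) (h : B.Smooth) : IsClosed {p : ℝ × E² | p.2 ∈ (B.frz p.1).supp} := by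
  have h0 : Continuous fun p : ℝ × E² => p.2 0 := (EuclideanSpace.proj (0 : Fin 2)).continuous.comp continuous_snd
  have h1 : Continuous fun p : ℝ × E² => p.2 1 := (EuclideanSpace.proj (1 : Fin 2)).continuous.comp continuous_snd
  have ca₀ : Continuous fun p : ℝ × E² => B.a₀ p.1 + B.ρ / 3 := (h.a₀.continuous.comp continuous_fst).add continuous_const
  have cb₀ : Continuous fun p : ℝ × E² => B.b₀ p.1 - B.ρ / 3 := (h.b₀.continuous.comp continuous_fst).sub continuous_const
  have ca₁ : Continuous fun p : ℝ × E² => B.a₁ p.1 + B.ρ / 3 := (h.a₁.continuous.comp continuous_fst).add continuous_const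
  have cb₁ : Continuous fun p : ℝ × E² => B.b₁ p.1 - B.ρ / 3 := (h.b₁.continuous.comp continuous_fst).sub continuous_const
  have hc := (((isClosed_le ca₀ h0).inter (isClosed_le h0 cb₀)).inter (isClosed_le ca₁ h1)).inter (isClosed_le h1 cb₁)
  convert hc using 1
  ext p
  simp only [mem_setOf_eq, BoxPlateau.supp, mem_inter_iff]
  tauto

end MovingBox

/-- **Moving chain data**: moving boxes of the elements and junction steps between consecutive elements. [folklore] -/
structure MovingChain where
  /-- number of elements -/
  K : ℕ
  /-- moving box of element `k` -/
  box : ℕ → MovingBox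
  /-- junction step between elements `j` and `j + 1` -/
  J : ℕ → JStep

namespace MovingChain

variable (M : MovingChain)

/-- **The frozen chain** at time `t`: the static chain with the boxes at time `t`. [folklore] -/
def frozen (t : ℝ) : ChainData := ⟨M.K, fun k => (M.box k).frz t, M.J⟩

/-- The frozen chain has the same number of elements. [folklore] -/
@[simp] theorem frozen_K (t : ℝ) : (M.frozen t).K = M.K := rfl

/-- The frozen chain has the boxes at time `t`. [folklore] -/
@[simp] theorem frozen_B (t : ℝ) (k : ℕ) : (M.frozen t).B k = (M.box k).frz t := rfl

/-- The frozen chain has the same steps. [folklore] -/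
@[simp] theorem frozen_J (t : ℝ) : (M.frozen t).J = M.J := rfl

/-- **The cut-off of a moving chain**: the frozen cut-off at the current time. [folklore] -/
def chi (k : ℕ) (t : ℝ) (z : E²) : ℝ := (M.frozen t).chi k t z

/-- Unfolding the cut-off. [folklore] -/
theorem chi_apply (k : ℕ) (t : ℝ) (z : E²) : M.chi k t z = (M.frozen t).chi k t z := rfl

/-- **Core region**: frozen core at the current time. [folklore] -/
def core (k : ℕ) : Set (ℝ × E²) := {p | p ∈ (M.frozen p.1).core k}

/-- **Junction region** (cut-off part): frozen junction region at the current time. [folklore] -/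
def juncCut (k : ℕ) : Set (ℝ × E²) := {p | p ∈ (M.frozen p.1).juncCut k}

/-- **Tube box**: frozen tube box at the current time. [folklore] -/
def tubeBox (k : ℕ) : Set (ℝ × E²) := {p | p ∈ (M.frozen p.1).tubeBox k}

/-- The out-steps of all frozen chains coincide. [folklore] -/
theorem frozen_sigmaOut (s t : ℝ) (k : ℕ) : (M.frozen s).sigmaOut k = (M.frozen t).sigmaOut k := rfl

/-- The in-steps of all frozen chains coincide. [folklore] -/
theorem frozen_sigmaIn (s t : ℝ) (k : ℕ) : (M.frozen s).sigmaIn k = (M.frozen t).sigmaIn k := rfl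

/-- **Well-formedness of a moving chain**: every frozen chain is a banded well-formed chain, and the edges of the
boxes are smooth. [folklore] -/
structure WFB (Band : ℕ → Set (ℝ × E²)) : Prop where
  /-- every frozen chain is banded well-formed -/
  frozen : ∀ t, (M.frozen t).WFB Band
  /-- edges move smoothly -/
  smooth : ∀ k < M.K, (M.box k).Smooth

variable {M} {Band : ℕ → Set (ℝ × E²)}

/-! ## Smoothness of the cut-offs and topology of the regions -/

/-- **The cut-offs of a well-formed moving chain are smooth** (for `k < K`). [folklore] -/
theorem WFB.contDiff_uncurry_chi (h : M.WFB Band) {k : ℕ} (hk : k < M.K) : ContDiff ℝ ∞ (uncurry (M.chi k)) := by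
  have hτ : ContDiff ℝ ∞ fun p : ℝ × E² => ((M.box k).frz p.1).val p.2 := (M.box k).contDiff_uncurry_val (h.smooth k hk)
  have hout : ∀ m, ContDiff ℝ ∞ (uncurry ((M.frozen 0).sigmaOut m)) := by
    intro m
    unfold ChainData.sigmaOut
    split_ifs with hm
    · exact (M.J m).contDiff_uncurry_val ((h.frozen 0).pos_smooth m hm)
    · exact contDiff_const
  have hin : ContDiff ℝ ∞ (uncurry ((M.frozen 0).sigmaIn k)) := by
    unfold ChainData.sigmaIn
    split_ifs
    · exact contDiff_const
    · exact hout _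
  have e : uncurry (M.chi k) = fun p : ℝ × E² =>
      ((M.box k).frz p.1).val p.2 * (uncurry ((M.frozen 0).sigmaIn k) p - uncurry ((M.frozen 0).sigmaOut k) p) := by
    funext p; rfl
  rw [e]
  exact hτ.mul (hin.sub (hout k))

/-- The core region of a well-formed moving chain is open. [folklore] -/
theorem WFB.isOpen_core (h : M.WFB Band) {k : ℕ} (hk : k < M.K) : IsOpen (M.core k) := by
  have e : M.core k = {p : ℝ × E² | p.2 ∈ ((M.box k).frz p.1).inner} ∩ (M.frozen 0).inOne k ∩ (M.frozen 0).outZero k := by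
    ext p; rfl
  rw [e]
  refine (((M.box k).isOpen_inner (h.smooth k hk)).inter ?_).inter ?_
  · by_cases h0 : k = 0
    · convert isOpen_univ (X := ℝ × E²); ext p; simp [ChainData.inOne, h0]
    · have hop := (M.J (k - 1)).isOpen_arg_gt ((h.frozen 0).pos_continuous (j := k - 1) (by simp; omega)) (2 / 3)
      convert hop using 1; ext p; simp [ChainData.inOne, h0]
  · by_cases hk1 : k + 1 < M.K
    · have hop := (M.J k).isOpen_arg_lt ((h.frozen 0).pos_continuous (by simpa using hk1)) (1 / 3)
      convert hop using 1; ext p; simp [ChainData.outZero, hk1]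
    · convert isOpen_univ (X := ℝ × E²); ext p; simp [ChainData.outZero, hk1]

/-- The junction region of a well-formed moving chain is open. [folklore] -/
theorem WFB.isOpen_juncCut (h : M.WFB Band) {k : ℕ} (hk : k + 1 < M.K) : IsOpen (M.juncCut k) := by
  have e : M.juncCut k = ({p : ℝ × E² | p.2 ∈ ((M.box k).frz p.1).inner} ∩ {p | p.2 ∈ ((M.box (k + 1)).frz p.1).inner}) ∩
      (M.frozen 0).inOne k ∩ (M.frozen 0).outZero (k + 1) := by
    ext p
    simp only [juncCut, ChainData.juncCut, mem_setOf_eq, mem_inter_iff, frozen_B]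
    rfl
  rw [e]
  refine ((((M.box k).isOpen_inner (h.smooth k (by omega))).inter
    ((M.box (k + 1)).isOpen_inner (h.smooth (k + 1) hk))).inter ?_).inter ?_
  · by_cases h0 : k = 0
    · convert isOpen_univ (X := ℝ × E²); ext p; simp [ChainData.inOne, h0]
    · have hop := (M.J (k - 1)).isOpen_arg_gt ((h.frozen 0).pos_continuous (j := k - 1) (by simp; omega)) (2 / 3)
      convert hop using 1; ext p; simp [ChainData.inOne, h0]
  · by_cases hk2 : k + 2 < M.K
    · have hop := (M.J (k + 1)).isOpen_arg_lt ((h.frozen 0).pos_continuous (by simpa using hk2)) (1 / 3)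
      convert hop using 1; ext p; simp [ChainData.outZero, hk2]
    · convert isOpen_univ (X := ℝ × E²); ext p; simp [ChainData.outZero, hk2]

/-- The tube box of a well-formed moving chain is closed. [folklore] -/
theorem WFB.isClosed_tubeBox (h : M.WFB Band) {k : ℕ} (hk : k < M.K) : IsClosed (M.tubeBox k) := by
  have e : M.tubeBox k = {p : ℝ × E² | p.2 ∈ ((M.box k).frz p.1).supp} ∩
      {p | k = 0 ∨ 1 / 3 ≤ (M.J (k - 1)).arg p.1 p.2} ∩ {p | k + 1 < M.K → (M.J k).arg p.1 p.2 ≤ 2 / 3} := by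
    ext p; rfl
  rw [e]
  refine (((M.box k).isClosed_supp (h.smooth k hk)).inter ?_).inter ?_
  · by_cases h0 : k = 0
    · convert isClosed_univ (X := ℝ × E²); ext p; simp [h0]
    · have hcl := (M.J (k - 1)).isClosed_arg_ge ((h.frozen 0).pos_continuous (j := k - 1) (by simp; omega)) (1 / 3)
      convert hcl using 1; ext p; simp [h0]
  · by_cases hk1 : k + 1 < M.K
    · have hcl := (M.J k).isClosed_arg_le ((h.frozen 0).pos_continuous (by simpa using hk1)) (2 / 3)
      convert hcl using 1; ext p; simp [hk1]
    · convert isClosed_univ (X := ℝ × E²); ext p; simp [hk1]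

/-! ## Region data and the move of a moving chain -/

section Move

variable {Θ H : ℕ → ℝ → E² → ℝ} {Agree : ℕ → Set (ℝ × E²)} {S : Set ℝ} {Q : Set E²} {H₀ Mb : ℝ}

/-- **Region data from a well-formed moving chain**: the frozen identities at the current time give the cut-off
identities; bands containing the supports of the `Θ_k`, open agreement regions and the per-element cover give the
rest. [folklore] -/
theorem WFB.isRegionData (h : M.WFB Band)
    (hband : ∀ k < M.K, ∀ p : ℝ × E², Θ k p.1 p.2 ≠ 0 → p ∈ Band k)
    (hAo : ∀ k, k + 1 < M.K → IsOpen (Agree k))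
    (hAΘ : ∀ k, k + 1 < M.K → ∀ p ∈ Agree k, Θ (k + 1) p.1 p.2 = Θ k p.1 p.2)
    (hAH : ∀ k, k + 1 < M.K → ∀ p ∈ Agree k, H (k + 1) p.1 p.2 = H k p.1 p.2)
    (hcover : ∀ t ∈ S, ∀ z ∈ Q, ∀ k < M.K, (t, z) ∈ M.tubeBox k ∩ Band k →
      (t, z) ∈ M.core k ∨ (0 < k ∧ (t, z) ∈ M.juncCut (k - 1) ∩ Agree (k - 1)) ∨
        (k + 1 < M.K ∧ (t, z) ∈ M.juncCut k ∩ Agree k)) :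
    IsRegionData M.K M.chi Θ H M.core (fun k => M.juncCut k ∩ Agree k) (fun k => M.tubeBox k ∩ Band k) S Q where
  isOpen_core k hk := h.isOpen_core hk
  isOpen_junc k hk := (h.isOpen_juncCut hk).inter (hAo k hk)
  isClosed_tube j hj := (h.isClosed_tubeBox hj).inter ((h.frozen 0).isClosed_band j hj)
  core_one k hk p hp :=
    ((h.frozen p.1).chi_core hk hp.1.1 ((M.frozen p.1).sigmaIn_eq_one_of_mem hk hp.1.2)
      ((M.frozen p.1).sigmaOut_eq_zero_of_mem hp.2)).1
  core_zero k hk p hp j hj hjk :=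
    ((h.frozen p.1).chi_core hk hp.1.1 ((M.frozen p.1).sigmaIn_eq_one_of_mem hk hp.1.2)
      ((M.frozen p.1).sigmaOut_eq_zero_of_mem hp.2)).2 j hj hjk
  junc_sum k hk p hp :=
    ((h.frozen p.1).chi_junction hk hp.1.1.1.1 hp.1.1.1.2 ((M.frozen p.1).sigmaIn_eq_one_of_mem (by simpa using by omega) hp.1.1.2)
      ((M.frozen p.1).sigmaOut_eq_zero_of_mem hp.1.2)).1
  junc_zero k hk p hp j hj hjk hjk1 :=
    ((h.frozen p.1).chi_junction hk hp.1.1.1.1 hp.1.1.1.2 ((M.frozen p.1).sigmaIn_eq_one_of_mem (by simpa using by omega) hp.1.1.2)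
      ((M.frozen p.1).sigmaOut_eq_zero_of_mem hp.1.2)).2 j hj hjk hjk1
  junc_scalar k hk p hp := hAΘ k hk p hp.2
  junc_stream k hk p hp := hAH k hk p hp.2
  tube j hj p hne := (h.frozen p.1).mem_tubeBox_of_mul_ne_zero hband hj hne
  cover t ht z hz hex := by
    obtain ⟨j, hj, hmem⟩ := hex
    rcases hcover t ht z hz j hj hmem with hc | ⟨hj0, hju⟩ | ⟨hj1, hju⟩
    · exact Or.inl ⟨j, hj, hc⟩
    · exact Or.inr ⟨j - 1, by omega, by
        have e : j - 1 + 1 = j := by omega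
        simpa only using hju⟩
    · exact Or.inr ⟨j, hj1, hju⟩

/-- **The assembled scalar of a moving chain is smooth.** [folklore] -/
theorem WFB.contDiff_uncurry_scalar (h : M.WFB Band) (hE : ChainData.BandedFacts (M.frozen 0) Θ H Mb Band) :
    ContDiff ℝ ∞ (uncurry (assembledScalar M.K M.chi Θ)) :=
  contDiff_uncurry_assembledScalar M.K M.chi Θ (fun _ hk => h.contDiff_uncurry_chi hk) hE.smooth_scalar

/-- **The assembled stream function of a moving chain is smooth.** [folklore] -/
theorem WFB.contDiff_uncurry_stream (h : M.WFB Band) (hE : ChainData.BandedFacts (M.frozen 0) Θ H Mb Band) :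
    ContDiff ℝ ∞ (uncurry (assembledStream M.K H₀ M.chi H)) :=
  contDiff_uncurry_assembledStream M.K H₀ M.chi H (fun _ hk => h.contDiff_uncurry_chi hk) hE.smooth_stream

/-- **The assembled velocity of a moving chain is smooth.** [folklore] -/
theorem WFB.contDiff_uncurry_velocity (h : M.WFB Band) (hE : ChainData.BandedFacts (M.frozen 0) Θ H Mb Band) :
    ContDiff ℝ ∞ (uncurry (assembledVelocity M.K H₀ M.chi H)) :=
  contDiff_uncurry_assembledVelocity M.K H₀ M.chi H (fun _ hk => h.contDiff_uncurry_chi hk) hE.smooth_stream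

/-- **The assembled velocity of a moving chain is divergence free everywhere.** [folklore] -/
theorem WFB.divergence_velocity (h : M.WFB Band) (hE : ChainData.BandedFacts (M.frozen 0) Θ H Mb Band) (t : ℝ) (z : E²) :
    ∑ j, fderiv ℝ (assembledVelocity M.K H₀ M.chi H t) z (EuclideanSpace.single j 1) j = 0 :=
  divergence_assembledVelocity M.K H₀ M.chi H (fun _ hk => h.contDiff_uncurry_chi hk) hE.smooth_stream t z

/-- **Transport of the move of a moving chain on `S × Q`.** [folklore] -/
theorem WFB.transport_move (h : M.WFB Band) (hE : ChainData.BandedFacts (M.frozen 0) Θ H Mb Band)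
    (hA : ChainData.BandedAgreement (M.frozen 0) Θ H Agree)
    (hcover : ∀ t ∈ S, ∀ z ∈ Q, ∀ k < M.K, (t, z) ∈ M.tubeBox k ∩ Band k →
      (t, z) ∈ M.core k ∨ (0 < k ∧ (t, z) ∈ M.juncCut (k - 1) ∩ Agree (k - 1)) ∨
        (k + 1 < M.K ∧ (t, z) ∈ M.juncCut k ∩ Agree k)) :
    ∀ t ∈ S, ∀ z ∈ Q, deriv (fun s => assembledScalar M.K M.chi Θ s z) t +
      fderiv ℝ (assembledScalar M.K M.chi Θ t) z (assembledVelocity M.K H₀ M.chi H t z) = 0 :=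
  transport_assembled_of_regions (h.isRegionData hE.band hA.isOpen hA.scalar hA.stream hcover)
    fun k hk t _ z _ => hE.transport k hk t z

/-- **The bound of the move of a moving chain on `S × Q`.** [folklore] -/
theorem WFB.abs_scalar_le (h : M.WFB Band) (hE : ChainData.BandedFacts (M.frozen 0) Θ H Mb Band)
    (hA : ChainData.BandedAgreement (M.frozen 0) Θ H Agree)
    (hcover : ∀ t ∈ S, ∀ z ∈ Q, ∀ k < M.K, (t, z) ∈ M.tubeBox k ∩ Band k →
      (t, z) ∈ M.core k ∨ (0 < k ∧ (t, z) ∈ M.juncCut (k - 1) ∩ Agree (k - 1)) ∨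
        (k + 1 < M.K ∧ (t, z) ∈ M.juncCut k ∩ Agree k)) :
    ∀ t ∈ S, ∀ z ∈ Q, |assembledScalar M.K M.chi Θ t z| ≤ Mb :=
  abs_assembledScalar_le_of_regions (h.isRegionData hE.band hA.isOpen hA.scalar hA.stream hcover) hE.M_nonneg
    fun k hk t _ z _ => hE.abs_le k hk t z

/-- **The assembled velocity of a moving chain vanishes off the (current) support boxes.** [folklore] -/
theorem WFB.velocity_eq_zero_off_boxes (h : M.WFB Band) {t : ℝ} {z : E²}
    (hz : ∀ k < M.K, z ∉ ((M.box k).frz t).supp) : assembledVelocity M.K H₀ M.chi H t z = 0 := by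
  refine assembledVelocity_eq_zero_off_streamTubes (TubeH := fun k => {p : ℝ × E² | p.2 ∈ ((M.box k).frz p.1).supp})
    (fun k hk => (M.box k).isClosed_supp (h.smooth k hk)) (fun k hk p hne => ?_) fun k hk hmem => hz k hk hmem
  by_contra hp
  exact hne (by rw [chi_apply, (h.frozen p.1).chi_eq_zero_of_not_mem hk hp, zero_mul])

/-- **The assembled scalar of a moving chain vanishes off the (current) support boxes.** [folklore] -/
theorem WFB.scalar_eq_zero_off_boxes (h : M.WFB Band) {t : ℝ} {z : E²}
    (hz : ∀ k < M.K, z ∉ ((M.box k).frz t).supp) : assembledScalar M.K M.chi Θ t z = 0 := by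
  rw [assembledScalar_apply]
  exact Finset.sum_eq_zero fun k hk => by
    rw [chi_apply, (h.frozen t).chi_eq_zero_of_not_mem (Finset.mem_range.1 hk) (hz k (Finset.mem_range.1 hk)), zero_mul]

/-- **The assembled scalar of a moving chain vanishes off the tubes** (tube box ∩ band). [folklore] -/
theorem WFB.scalar_eq_zero_off_tubes (h : M.WFB Band) (hE : ChainData.BandedFacts (M.frozen 0) Θ H Mb Band) {t : ℝ} {z : E²}
    (hz : ∀ k < M.K, (t, z) ∉ M.tubeBox k ∩ Band k) : assembledScalar M.K M.chi Θ t z = 0 :=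
  assembledScalar_eq_zero_off_tubes (Tube := fun k => M.tubeBox k ∩ Band k)
    (fun _ hk p hne => (h.frozen p.1).mem_tubeBox_of_mul_ne_zero hE.band hk hne) hz

/-- **On the core of an element the move of a moving chain is that element.** [folklore] -/
theorem WFB.move_eq_of_core (h : M.WFB Band) {k : ℕ} (hk : k < M.K) {t : ℝ} {z : E²} (hp : (t, z) ∈ M.core k) :
    assembledScalar M.K M.chi Θ t z = Θ k t z ∧ assembledVelocity M.K H₀ M.chi H t z = perpGrad (H k t) z := by
  have hopen := h.isOpen_core hk
  have h1 : ∀ᶠ p in 𝓝 (t, z), M.chi k p.1 p.2 = 1 :=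
    eventually_of_mem_open (P := fun s w => M.chi k s w = 1) hopen hp fun p hp' =>
      ((h.frozen p.1).chi_core hk hp'.1.1 ((M.frozen p.1).sigmaIn_eq_one_of_mem hk hp'.1.2)
        ((M.frozen p.1).sigmaOut_eq_zero_of_mem hp'.2)).1
  have h0 : ∀ j < M.K, j ≠ k → ∀ᶠ p in 𝓝 (t, z), M.chi j p.1 p.2 = 0 := fun j hj hjk =>
    eventually_of_mem_open (P := fun s w => M.chi j s w = 0) hopen hp fun p hp' =>
      ((h.frozen p.1).chi_core hk hp'.1.1 ((M.frozen p.1).sigmaIn_eq_one_of_mem hk hp'.1.2)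
        ((M.frozen p.1).sigmaOut_eq_zero_of_mem hp'.2)).2 j hj hjk
  exact assembled_eq_prescribed_of_core (Θg := Θ k) (Hg := H k) hk h1 h0 (Eventually.of_forall fun _ => rfl)
    (Eventually.of_forall fun _ => rfl)

/-- **Agreement with a prescribed pair on a core** (gate windows). [folklore] -/
theorem WFB.move_eq_prescribed_of_core (h : M.WFB Band) {k : ℕ} (hk : k < M.K) {Θg Hg : ℝ → E² → ℝ}
    (hΘ : ∀ p ∈ M.core k, Θ k p.1 p.2 = Θg p.1 p.2) (hH : ∀ p ∈ M.core k, H k p.1 p.2 = Hg p.1 p.2)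
    {t : ℝ} {z : E²} (hp : (t, z) ∈ M.core k) :
    assembledScalar M.K M.chi Θ t z = Θg t z ∧ assembledVelocity M.K H₀ M.chi H t z = perpGrad (Hg t) z := by
  have hopen := h.isOpen_core hk
  have h1 : ∀ᶠ p in 𝓝 (t, z), M.chi k p.1 p.2 = 1 :=
    eventually_of_mem_open (P := fun s w => M.chi k s w = 1) hopen hp fun p hp' =>
      ((h.frozen p.1).chi_core hk hp'.1.1 ((M.frozen p.1).sigmaIn_eq_one_of_mem hk hp'.1.2)
        ((M.frozen p.1).sigmaOut_eq_zero_of_mem hp'.2)).1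
  have h0 : ∀ j < M.K, j ≠ k → ∀ᶠ p in 𝓝 (t, z), M.chi j p.1 p.2 = 0 := fun j hj hjk =>
    eventually_of_mem_open (P := fun s w => M.chi j s w = 0) hopen hp fun p hp' =>
      ((h.frozen p.1).chi_core hk hp'.1.1 ((M.frozen p.1).sigmaIn_eq_one_of_mem hk hp'.1.2)
        ((M.frozen p.1).sigmaOut_eq_zero_of_mem hp'.2)).2 j hj hjk
  exact assembled_eq_prescribed_of_core hk h1 h0
    (eventually_of_mem_open (P := fun s w => Θ k s w = Θg s w) hopen hp hΘ)
    (eventually_of_mem_open (P := fun s w => H k s w = Hg s w) hopen hp hH)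

end Move

end MovingChain

end PlanarKinematics

end Literature.Analysis.FluidPDE
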